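import Summits.AtomisticToContinuum.Crystallization.Theorems.FrustratedLawDichotomyStrainedPatchHomEntryLeafHT4

/-!
# `entryLeafOKHTU` KIT: the REDUCED LABEL UNIVERSE of the analytic-slab leaf (undeformed-radius exclusion test) and the all-naive far slope chunks
# (27623 `(H) HomFloor (1/625)`, hcp half; critic rows 1185 (iii) / 1187 «cert-cost lever: fused checker»)

decomp-a2c hand-1 g32 (crux `AperiodicFrustratedLawGap`, stmt-AtomisticToContinuum-27623).  KERNEL COST FINDING (hand-1 g32, cell `…Cross090A.cX90 × wX`):
every one of the eight certificate facts of `…HomEntryLeafHT4.htCertSide` pays `≈ 62 s` for the classification scan of the `12167` labels of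
`…HomForceJacFar.boxLabels11 = [−11,11]³` by the interval squared radius `fjQ` (`≈ 5 ms` a label), although only `≈ 1100` labels are within `7`;
and the far slope chunks pay `≈ 60 ms` a label for the CENTRED slope arrays although their contribution to `Gs` is `< 1 %`.  This kit removes both:

* §1 the undeformed squared radius `hexN b = 12·‖Σ bᵢfᵢ + hcpShift‖²` (exact integer, `…HomLatticeBoxHcp.norm_sq_hexPt_add_shift`), the row-sum
  deviation bound `htK = htκ₀ + htκ₁ + htκ₂` (`‖Uv − v‖ ≤ (htK/SC)‖v‖` on the entry box, `norm_sub_self_le`), the shuffle bound `htZeta` (`‖ξ‖ ≤ htZeta/SC`),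
  the threshold `htNmin` and the REDUCED UNIVERSE `htUniv c w` (labels of `[−11,11]³` with `hexN b < htNmin c w`; `1218` labels at `cX90`, one
  integer quadratic form per label) with ★ `seven_lt_norm_of_not_mem_htUniv`: every label of `[−11,11]³` outside `htUniv` is OUTSIDE the `7`-ball at
  every `(U, ξ)` of the cell (`‖U(P_b + ξ)‖ ≥ (1 − htK/SC)(‖P_b‖ − ‖ξ‖) > 7`);
* §2 the label lists of `…HomEntryLeafHTKit` re-issued over `htUniv` (`htNearU/htCenU/htNaiU/htFar1U/htFar2U/htBU/htRU/htROKU`) with the same bookkeeping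
  lemmas (`mem_htBU_of_htIn`, `htBU_nodup`, `htIn_of_mem_htBU`, `mem_htUniv_of_mem_htBU`);
* §3 the ALL-NAIVE chunk slope `htGsN c w L := slopeGsLJ c (refW w) [] L` with guard `htNaiOKN`, ★ `refForce_chunkN_le` (instance `Lc = []` of
  `…HomEntryLeafHT3.refForce_chunk_le`'s chain) and ★ `refForce_htBU_le` (near chunk centred, far chunks naive).

Kernel definitions + soundness; 0 sorry; standard axioms; no instances / notation / `#eval`.  `--supports stmt-AtomisticToContinuum-27623`.
-/

noncomputable section

namespace Summit.AtomisticToContinuum.Crystallization.Theorems.FrustratedLawDichotomyStrainedPatchHomEntryLeafHT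

open scoped BigOperators RealInnerProductSpace
open Literature.Analysis.ValidatedNumerics.Numerics
open Summit.AtomisticToContinuum.Crystallization.Theorems.ChargedEnergyGapNegative (E3)
open Summit.AtomisticToContinuum.Crystallization.Theorems.FrustratedLawDichotomyStrainedPatchHomSplit (ExRec latPt hexFrame hcpShift HomFloor)
open Summit.AtomisticToContinuum.Crystallization.Theorems.FrustratedLawDichotomyStrainedPatchHomCoords (apply_eq_sum_entries)
open Summit.AtomisticToContinuum.Crystallization.Theorems.FrustratedLawDichotomyStrainedPatchHomLatticeBoxHcp (norm_sq_hexPt_add_shift shifted_eq_apply)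
open Summit.AtomisticToContinuum.Crystallization.Theorems.FrustratedLawDichotomyStrainedPatchHomCurvCentreKit (cenShuf cenShuf_apply)
open Summit.AtomisticToContinuum.Crystallization.Theorems.FrustratedLawDichotomyStrainedPatchHomCurvLeaf
  (nodup_filter_append toFinset_filter_append)
open Summit.AtomisticToContinuum.Crystallization.Theorems.FrustratedLawDichotomyStrainedPatchHomCurvLeafL2 (refW)
open Summit.AtomisticToContinuum.Crystallization.Theorems.FrustratedLawDichotomyStrainedPatchHomCurvLJ (isCenLJ curvCheckLJM naiveLJ)
open Summit.AtomisticToContinuum.Crystallization.Theorems.FrustratedLawDichotomyStrainedPatchHomForceJacN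
  (fjQ fjVec fjE fjX forceJacCheckN boxLabels11 boxLabels11_toFinset boxLabels11_nodup)
open Summit.AtomisticToContinuum.Crystallization.Theorems.FrustratedLawDichotomyStrainedPatchHomSlopeLJ
  (slopeLJLabelOK slopeCheckLJ slopeGsLJ slopeCheckLJ_slopeGsLJ forceLJ_ref_bound_of_check)

/-! ## §1. The reduced label universe -/

/-- `12·‖P_b‖²` for the undeformed shifted point `P_b = Σ bᵢfᵢ + hcpShift`: `3(2b₀ + b₁ + 1)² + (3b₁ + 1)² + 8(2b₂ + 1)²` (exact integer). -/
def hexN (b : Fin 3 → ℤ) : ℤ := 3 * (2 * b 0 + b 1 + 1) ^ 2 + (3 * b 1 + 1) ^ 2 + 8 * (2 * b 2 + 1) ^ 2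

/-- `hexN b = 12·‖latPt 1 hexFrame b + hcpShift‖²`. [arithmetic: `…HomLatticeBoxHcp.norm_sq_hexPt_add_shift`] -/
theorem hexN_cast (b : Fin 3 → ℤ) : (hexN b : ℝ) = 12 * ‖latPt 1 hexFrame b + hcpShift‖ ^ 2 := by
  rw [norm_sq_hexPt_add_shift]
  simp only [hexN]
  push_cast
  ring

/-- Scaled row-sum deviation bound of the cell: `htκ₀ + htκ₁ + htκ₂ ≥ SC·Σ_k Σ_j |U_kj − δ_kj|` on the entry box. -/
def htK (c w : (Fin 3 × Fin 3) ⊕ Fin 3 → ℤ) : ℤ := htκ c w 0 + htκ c w 1 + htκ c w 2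

/-- Scaled `ℓ¹` bound of the shuffle on the cell: `Σ_i (|c_i| + w_i) ≥ SC·‖ξ‖`. -/
def htZeta (c w : (Fin 3 × Fin 3) ⊕ Fin 3 → ℤ) : ℤ := ∑ i : Fin 3, (|c (Sum.inr i)| + w (Sum.inr i))

/-- Scaled radius threshold: an undeformed shifted point at distance `≥ htRad/SC` is certainly outside the `7`-ball on the cell. -/
def htRad (c w : (Fin 3 × Fin 3) ⊕ Fin 3 → ℤ) : ℤ := cdiv (7 * (SC : ℤ) * SC) (SC - htK c w) + htZeta c w + 1

/-- The integer threshold on `hexN`: `⌈12·htRad²/SC²⌉`. -/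
def htNmin (c w : (Fin 3 × Fin 3) ⊕ Fin 3 → ℤ) : ℤ := cdiv (12 * htRad c w ^ 2) ((SC : ℤ) * SC)

/-- ★ THE REDUCED LABEL UNIVERSE: labels of `[−11,11]³` that are not certainly outside the `7`-ball by the undeformed-radius test. -/
def htUniv (c w : (Fin 3 × Fin 3) ⊕ Fin 3 → ℤ) : List (Fin 3 → ℤ) := boxLabels11.filter fun b => decide (hexN b < htNmin c w)

/-- Labels of the universe are box labels. [formal bookkeeping] -/
theorem mem_boxLabels11_of_mem_htUniv {c w : (Fin 3 × Fin 3) ⊕ Fin 3 → ℤ} {b : Fin 3 → ℤ} (h : b ∈ htUniv c w) : b ∈ boxLabels11 :=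
  (List.mem_filter.1 h).1

/-- The universe is duplicate-free. [formal bookkeeping] -/
theorem htUniv_nodup (c w : (Fin 3 × Fin 3) ⊕ Fin 3 → ℤ) : (htUniv c w).Nodup := boxLabels11_nodup.filter _

/-- ★ Row-sum deviation: `‖Uv − v‖ ≤ (htK/SC)·‖v‖` for every `U` of the entry box. [folklore: `…HomEntryLeafHT.rowDev_le`] -/
theorem norm_sub_self_le {c w : (Fin 3 × Fin 3) ⊕ Fin 3 → ℤ} (U : E3 →L[ℝ] E3)
    (hbox : ∀ ab : Fin 3 × Fin 3, |(U (EuclideanSpace.single ab.2 (1 : ℝ))) ab.1 - (c (Sum.inl ab) : ℝ) / SC| ≤ (w (Sum.inl ab) : ℝ) / SC) (v : E3) :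
    ‖U v - v‖ ≤ (htK c w : ℝ) / SC * ‖v‖ := by
  have hrow := rowDev_le U hbox
  -- a coordinate is bounded by the Euclidean norm; the Euclidean norm by the `ℓ¹` norm
  have habs : ∀ (y : E3) (j : Fin 3), |y j| ≤ ‖y‖ := fun y j => by
    have h : |y j| ^ 2 ≤ ‖y‖ ^ 2 := by
      rw [EuclideanSpace.norm_sq_eq]
      have := Finset.single_le_sum (f := fun i : Fin 3 => ‖y i‖ ^ 2) (fun i _ => sq_nonneg _) (Finset.mem_univ j)
      simpa only [Real.norm_eq_abs] using this
    exact (abs_le_of_sq_le_sq' h (norm_nonneg _)).2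
  have hl1 : ∀ y : E3, ‖y‖ ≤ |y 0| + |y 1| + |y 2| := fun y => by
    have hsq : ‖y‖ ^ 2 = |y 0| ^ 2 + |y 1| ^ 2 + |y 2| ^ 2 := by
      rw [EuclideanSpace.norm_sq_eq, Fin.sum_univ_three, Real.norm_eq_abs, Real.norm_eq_abs, Real.norm_eq_abs]
    have h : ‖y‖ ^ 2 ≤ (|y 0| + |y 1| + |y 2|) ^ 2 := by
      rw [hsq]; nlinarith [abs_nonneg (y 0), abs_nonneg (y 1), abs_nonneg (y 2)]
    exact (abs_le_of_sq_le_sq' h (by positivity)).2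
  have hk : ∀ k : Fin 3, |(U v - v) k| ≤ (htκ c w k : ℝ) / SC * ‖v‖ := by
    intro k
    have hvk : v k = ∑ j : Fin 3, (if k = j then (1 : ℝ) else 0) * v j := by
      rw [Fin.sum_univ_three]
      fin_cases k <;> simp
    have e : (U v - v) k = ∑ j : Fin 3, ((U (EuclideanSpace.single j (1 : ℝ))) k - (if k = j then (1 : ℝ) else 0)) * v j := by
      rw [PiLp.sub_apply, apply_eq_sum_entries U v k]
      conv_lhs => rw [hvk]
      rw [← Finset.sum_sub_distrib]
      exact Finset.sum_congr rfl fun j _ => by ring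
    rw [e]
    refine (Finset.abs_sum_le_sum_abs _ _).trans ?_
    have h1 : ∑ j : Fin 3, |((U (EuclideanSpace.single j (1 : ℝ))) k - (if k = j then (1 : ℝ) else 0)) * v j| ≤
        ∑ j : Fin 3, |(U (EuclideanSpace.single j (1 : ℝ))) k - (if k = j then (1 : ℝ) else 0)| * ‖v‖ := by
      refine Finset.sum_le_sum fun j _ => ?_
      rw [abs_mul]
      exact mul_le_mul_of_nonneg_left (habs v j) (abs_nonneg _)
    refine h1.trans ?_
    rw [← Finset.sum_mul]
    exact mul_le_mul_of_nonneg_right (hrow k) (norm_nonneg _)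
  refine (hl1 (U v - v)).trans ?_
  have e : (htK c w : ℝ) / SC * ‖v‖ = (htκ c w 0 : ℝ) / SC * ‖v‖ + (htκ c w 1 : ℝ) / SC * ‖v‖ + (htκ c w 2 : ℝ) / SC * ‖v‖ := by
    simp only [htK, Int.cast_add]; ring
  rw [e]
  exact add_le_add (add_le_add (hk 0) (hk 1)) (hk 2)

/-- ★ The shuffle bound: `‖ξ‖ ≤ htZeta/SC` on the shuffle box. [folklore] -/
theorem norm_xi_le_htZeta {c w : (Fin 3 × Fin 3) ⊕ Fin 3 → ℤ} {ξ : E3} (hξ : ∀ i : Fin 3, |ξ i - (c (Sum.inr i) : ℝ) / SC| ≤ (w (Sum.inr i) : ℝ) / SC) :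
    ‖ξ‖ ≤ (htZeta c w : ℝ) / SC := by
  have hS : (0 : ℝ) < SC := by norm_num [SC]
  have hi : ∀ i : Fin 3, |ξ i| ≤ ((|c (Sum.inr i)| + w (Sum.inr i) : ℤ) : ℝ) / SC := by
    intro i
    have h1 := hξ i
    have h2 : |ξ i| ≤ |ξ i - (c (Sum.inr i) : ℝ) / SC| + |(c (Sum.inr i) : ℝ) / SC| := by
      have := abs_add_le (ξ i - (c (Sum.inr i) : ℝ) / SC) ((c (Sum.inr i) : ℝ) / SC)
      rwa [sub_add_cancel] at this
    rw [abs_div, abs_of_pos hS] at h2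
    have e : ((|c (Sum.inr i)| + w (Sum.inr i) : ℤ) : ℝ) / SC = |(c (Sum.inr i) : ℝ)| / SC + (w (Sum.inr i) : ℝ) / SC := by
      push_cast; ring
    rw [e]
    linarith
  have hl1 : ‖ξ‖ ≤ |ξ 0| + |ξ 1| + |ξ 2| := by
    have hsq : ‖ξ‖ ^ 2 = |ξ 0| ^ 2 + |ξ 1| ^ 2 + |ξ 2| ^ 2 := by
      rw [EuclideanSpace.norm_sq_eq, Fin.sum_univ_three, Real.norm_eq_abs, Real.norm_eq_abs, Real.norm_eq_abs]
    have h : ‖ξ‖ ^ 2 ≤ (|ξ 0| + |ξ 1| + |ξ 2|) ^ 2 := by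
      rw [hsq]; nlinarith [abs_nonneg (ξ 0), abs_nonneg (ξ 1), abs_nonneg (ξ 2)]
    exact (abs_le_of_sq_le_sq' h (by positivity)).2
  refine hl1.trans ?_
  have e : (htZeta c w : ℝ) / SC = ((|c (Sum.inr 0)| + w (Sum.inr 0) : ℤ) : ℝ) / SC + ((|c (Sum.inr 1)| + w (Sum.inr 1) : ℤ) : ℝ) / SC +
      ((|c (Sum.inr 2)| + w (Sum.inr 2) : ℤ) : ℝ) / SC := by
    simp only [htZeta, Fin.sum_univ_three, Int.cast_add, add_div]
  rw [e]
  exact add_le_add (add_le_add (hi 0) (hi 1)) (hi 2)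

/-- ★★ **EXCLUSION**: a label of `[−11,11]³` outside the reduced universe is OUTSIDE the `7`-ball at every `(U, ξ)` of the cell (`htK < SC`). [folklore:
`‖U(P + ξ)‖ ≥ (1 − htK/SC)(‖P‖ − htZeta/SC)` and `‖P‖ ≥ htRad/SC` from `hexN b ≥ htNmin`] -/
theorem seven_lt_norm_of_not_mem_htUniv {c w : (Fin 3 × Fin 3) ⊕ Fin 3 → ℤ} (U : E3 →L[ℝ] E3)
    (hbox : ∀ ab : Fin 3 × Fin 3, |(U (EuclideanSpace.single ab.2 (1 : ℝ))) ab.1 - (c (Sum.inl ab) : ℝ) / SC| ≤ (w (Sum.inl ab) : ℝ) / SC)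
    {ξ : E3} (hξ : ∀ i : Fin 3, |ξ i - (c (Sum.inr i) : ℝ) / SC| ≤ (w (Sum.inr i) : ℝ) / SC) (hK : htK c w < (SC : ℤ))
    {b : Fin 3 → ℤ} (hb : b ∈ boxLabels11) (hnot : b ∉ htUniv c w) : 7 < ‖latPt U hexFrame b + U (hcpShift + ξ)‖ := by
  have hS : (0 : ℝ) < SC := by norm_num [SC]
  -- `hexN b ≥ htNmin`
  have hN : htNmin c w ≤ hexN b := by
    by_contra hlt
    exact hnot (List.mem_filter.2 ⟨hb, by simp only [decide_eq_true_eq]; omega⟩)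
  rw [shifted_eq_apply]
  set P : E3 := latPt 1 hexFrame b + hcpShift with hPdef
  have hks : (htK c w : ℝ) < SC := by exact_mod_cast hK
  have ht : (0 : ℝ) < SC - htK c w := by linarith
  -- `q (SC − K) ≥ 7 SC²`
  have hq : 7 * ((SC : ℝ) * SC) ≤ ((cdiv (7 * (SC : ℤ) * SC) (SC - htK c w) : ℤ) : ℝ) * ((SC : ℝ) - htK c w) := by
    have hcd := div_le_cdiv (a := 7 * (SC : ℤ) * SC) (b := (SC : ℤ) - htK c w) (by omega)
    have hcd' : ((7 * (SC : ℤ) * SC : ℤ) : ℝ) / (((SC : ℤ) - htK c w : ℤ) : ℝ) ≤ ((cdiv (7 * (SC : ℤ) * SC) (SC - htK c w) : ℤ) : ℝ) := by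
      exact_mod_cast hcd
    push_cast at hcd'
    rw [div_le_iff₀ ht] at hcd'
    linarith
  -- `0 ≤ htZeta` (the shuffle half-widths are nonnegative by `hξ`)
  have hz0 : (0 : ℝ) ≤ htZeta c w := by
    simp only [htZeta]
    push_cast
    refine Finset.sum_nonneg fun i _ => add_nonneg (abs_nonneg _) ?_
    have := (abs_nonneg _).trans (hξ i)
    rw [le_div_iff₀ hS, zero_mul] at this
    exact this
  have hR : (htRad c w : ℝ) = ((cdiv (7 * (SC : ℤ) * SC) (SC - htK c w) : ℤ) : ℝ) + htZeta c w + 1 := by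
    simp only [htRad]; push_cast; ring
  have hq0 : (0 : ℝ) ≤ ((cdiv (7 * (SC : ℤ) * SC) (SC - htK c w) : ℤ) : ℝ) := by
    nlinarith [mul_pos hS hS, ht, hq]
  have hR0 : (0 : ℝ) ≤ htRad c w := by rw [hR]; linarith
  -- `‖P‖ ≥ htRad/SC`
  have hP : (htRad c w : ℝ) / SC ≤ ‖P‖ := by
    have hcd := div_le_cdiv (a := 12 * htRad c w ^ 2) (b := (SC : ℤ) * SC) (by norm_num [SC])
    have h1 : ((cdiv (12 * htRad c w ^ 2) ((SC : ℤ) * SC) : ℤ) : ℝ) ≤ (hexN b : ℝ) := by exact_mod_cast hN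
    have h2 : ((12 * htRad c w ^ 2 : ℤ) : ℝ) / (((SC : ℤ) * SC : ℤ) : ℝ) ≤ (hexN b : ℝ) := le_trans (by exact_mod_cast hcd) h1
    rw [hexN_cast, ← hPdef] at h2
    push_cast at h2
    rw [div_le_iff₀ (mul_pos hS hS)] at h2
    have hsq : ((htRad c w : ℝ) / SC) ^ 2 ≤ ‖P‖ ^ 2 := by
      rw [div_pow, div_le_iff₀ (pow_pos hS 2)]
      nlinarith [h2]
    exact (abs_le_of_sq_le_sq' hsq (norm_nonneg _)).2
  -- `‖P + ξ‖ ≥ (q + 1)/SC`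
  have hξn : ‖ξ‖ ≤ (htZeta c w : ℝ) / SC := norm_xi_le_htZeta hξ
  have h3 : ‖P‖ ≤ ‖P + ξ‖ + ‖ξ‖ := by simpa using norm_add_le (P + ξ) (-ξ)
  have hv : (((cdiv (7 * (SC : ℤ) * SC) (SC - htK c w) : ℤ) : ℝ) + 1) / SC ≤ ‖P + ξ‖ := by
    have e : (((cdiv (7 * (SC : ℤ) * SC) (SC - htK c w) : ℤ) : ℝ) + 1) / SC = (htRad c w : ℝ) / SC - (htZeta c w : ℝ) / SC := by
      rw [hR]; ring
    rw [e]
    linarith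
  -- `‖U(P + ξ)‖ ≥ (1 − K/SC)‖P + ξ‖`
  have hUv : ((SC : ℝ) - htK c w) / SC * ‖P + ξ‖ ≤ ‖U (P + ξ)‖ := by
    have h1 := norm_sub_self_le U hbox (P + ξ)
    have h2 := norm_sub_norm_le (P + ξ) (U (P + ξ))
    rw [norm_sub_rev] at h2
    have e : ((SC : ℝ) - htK c w) / SC * ‖P + ξ‖ = ‖P + ξ‖ - (htK c w : ℝ) / SC * ‖P + ξ‖ := by
      field_simp
    rw [e]
    linarith
  -- combine
  have key : (7 : ℝ) < ((SC : ℝ) - htK c w) / SC * ((((cdiv (7 * (SC : ℤ) * SC) (SC - htK c w) : ℤ) : ℝ) + 1) / SC) := by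
    rw [div_mul_div_comm, lt_div_iff₀ (mul_pos hS hS)]
    nlinarith [hq, ht]
  calc (7 : ℝ) < ((SC : ℝ) - htK c w) / SC * ((((cdiv (7 * (SC : ℤ) * SC) (SC - htK c w) : ℤ) : ℝ) + 1) / SC) := key
    _ ≤ ((SC : ℝ) - htK c w) / SC * ‖P + ξ‖ := mul_le_mul_of_nonneg_left hv (div_nonneg ht.le hS.le)
    _ ≤ ‖U (P + ξ)‖ := hUv

/-! ## §2. The label lists over the reduced universe -/

/-- Near labels of the universe: certainly inside, squared-radius lower end `< 22.09`. -/
def htNearU (c w : (Fin 3 × Fin 3) ⊕ Fin 3 → ℤ) : List (Fin 3 → ℤ) :=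
  (htUniv c w).filter fun b => htIn c w b && decide ((fjQ c w b).lo < htA1)

/-- Centred near labels of the universe. -/
def htCenU (c w : (Fin 3 × Fin 3) ⊕ Fin 3 → ℤ) : List (Fin 3 → ℤ) := (htNearU c w).filter fun b => isCenLJ c w b

/-- Naive near labels of the universe. -/
def htNaiU (c w : (Fin 3 × Fin 3) ⊕ Fin 3 → ℤ) : List (Fin 3 → ℤ) := (htNearU c w).filter fun b => !isCenLJ c w b

/-- Far chunk 1 of the universe: certainly inside, squared-radius lower end in `[22.09, 36)`. -/
def htFar1U (c w : (Fin 3 × Fin 3) ⊕ Fin 3 → ℤ) : List (Fin 3 → ℤ) :=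
  (htUniv c w).filter fun b => htIn c w b && !decide ((fjQ c w b).lo < htA1) && decide ((fjQ c w b).lo < 36 * (SC : ℤ))

/-- Far chunk 2 of the universe: certainly inside, squared-radius lower end `≥ 36`. -/
def htFar2U (c w : (Fin 3 × Fin 3) ⊕ Fin 3 → ℤ) : List (Fin 3 → ℤ) :=
  (htUniv c w).filter fun b => htIn c w b && !decide ((fjQ c w b).lo < htA1) && !decide ((fjQ c w b).lo < 36 * (SC : ℤ))

/-- All certainly-inside labels of the universe, in certificate order `((centred ++ naive) ++ far₁) ++ far₂`. -/
def htBU (c w : (Fin 3 × Fin 3) ⊕ Fin 3 → ℤ) : List (Fin 3 → ℤ) := ((htCenU c w ++ htNaiU c w) ++ htFar1U c w) ++ htFar2U c w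

/-- Straddlers of the universe: not certainly inside, but possibly inside. -/
def htRU (c w : (Fin 3 × Fin 3) ⊕ Fin 3 → ℤ) : List (Fin 3 → ℤ) :=
  (htUniv c w).filter fun b => !htIn c w b && decide ((fjQ c w b).lo ≤ 49 * (SC : ℤ))

/-- Every straddler of the universe is certainly `≥ 6` from the centre. -/
def htROKU (c w : (Fin 3 × Fin 3) ⊕ Fin 3 → ℤ) : Bool := (htRU c w).all fun b => decide (36 * (SC : ℤ) ≤ (fjQ c w b).lo)

/-- Every certainly-inside label of the universe lies in `htBU`. [formal bookkeeping] -/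
theorem mem_htBU_of_htIn {c w : (Fin 3 × Fin 3) ⊕ Fin 3 → ℤ} {b : Fin 3 → ℤ} (hb : b ∈ htUniv c w) (h : htIn c w b = true) : b ∈ htBU c w := by
  simp only [htBU, List.mem_append, htCenU, htNaiU, htNearU, htFar1U, htFar2U, List.mem_filter, hb, h, Bool.true_and, true_and]
  by_cases h1 : decide ((fjQ c w b).lo < htA1) = true
  · by_cases hc : isCenLJ c w b = true
    · exact Or.inl (Or.inl (Or.inl ⟨h1, hc⟩))
    · exact Or.inl (Or.inl (Or.inr ⟨h1, by simp [hc]⟩))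
  · by_cases h2 : decide ((fjQ c w b).lo < 36 * (SC : ℤ)) = true
    · exact Or.inl (Or.inr (by simp [h1, h2]))
    · exact Or.inr (by simp [h1, h2])

/-- `htBU` is duplicate-free. [formal bookkeeping: verbatim `…HomEntryLeafHTKit.htB_nodup` over the universe] -/
theorem htBU_nodup (c w : (Fin 3 × Fin 3) ⊕ Fin 3 → ℤ) : (htBU c w).Nodup := by
  have hN : (htNearU c w).Nodup := (htUniv_nodup c w).filter _
  have h12 : (htCenU c w ++ htNaiU c w).Nodup := nodup_filter_append hN _
  have hF1 : (htFar1U c w).Nodup := (htUniv_nodup c w).filter _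
  have hF2 : (htFar2U c w).Nodup := (htUniv_nodup c w).filter _
  have hmemN : ∀ b ∈ htCenU c w ++ htNaiU c w, decide ((fjQ c w b).lo < htA1) = true := by
    intro b hb
    rcases List.mem_append.1 hb with hb | hb
    · have := (List.mem_filter.1 (List.mem_filter.1 hb).1).2; simp only [Bool.and_eq_true] at this; exact this.2
    · have := (List.mem_filter.1 (List.mem_filter.1 hb).1).2; simp only [Bool.and_eq_true] at this; exact this.2
  have h123 : ((htCenU c w ++ htNaiU c w) ++ htFar1U c w).Nodup := by
    rw [List.nodup_append]
    refine ⟨h12, hF1, fun a ha b hb hab => ?_⟩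
    subst hab
    have h1 := hmemN a ha
    have h2 := (List.mem_filter.1 hb).2
    simp only [Bool.and_eq_true, Bool.not_eq_true'] at h2
    rw [h1] at h2
    exact Bool.noConfusion h2.1.2
  rw [htBU, List.nodup_append]
  refine ⟨h123, hF2, fun a ha b hb hab => ?_⟩
  subst hab
  have h2 := (List.mem_filter.1 hb).2
  simp only [Bool.and_eq_true, Bool.not_eq_true'] at h2
  rcases List.mem_append.1 ha with ha | ha
  · have h1 := hmemN a ha
    rw [h1] at h2
    exact Bool.noConfusion h2.1.2
  · have h1 := (List.mem_filter.1 ha).2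
    simp only [Bool.and_eq_true, Bool.not_eq_true'] at h1
    rw [h1.2] at h2
    exact Bool.noConfusion h2.2

/-- Labels of `htBU` are universe labels. [formal bookkeeping] -/
theorem mem_htUniv_of_mem_htBU {c w : (Fin 3 × Fin 3) ⊕ Fin 3 → ℤ} {b : Fin 3 → ℤ} (h : b ∈ htBU c w) : b ∈ htUniv c w := by
  simp only [htBU, List.mem_append, htCenU, htNaiU, htNearU, htFar1U, htFar2U, List.mem_filter] at h
  rcases h with ((⟨⟨h, _⟩, _⟩ | ⟨⟨h, _⟩, _⟩) | ⟨h, _⟩) | ⟨h, _⟩ <;> exact h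

/-- Labels of `htBU` are certainly inside. [formal bookkeeping] -/
theorem htIn_of_mem_htBU {c w : (Fin 3 × Fin 3) ⊕ Fin 3 → ℤ} {b : Fin 3 → ℤ} (h : b ∈ htBU c w) : htIn c w b = true := by
  simp only [htBU, List.mem_append, htCenU, htNaiU, htNearU, htFar1U, htFar2U, List.mem_filter, Bool.and_eq_true] at h
  rcases h with ((⟨⟨_, h, _⟩, _⟩ | ⟨⟨_, h, _⟩, _⟩) | ⟨_, ⟨h, _⟩, _⟩) | ⟨_, ⟨h, _⟩, _⟩ <;> exact h

/-! ## §3. All-naive chunk slope and the reference force bound over `htBU` -/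

/-- The naive guard of a chunk whose labels ALL go through the naive slope path (reference box). -/
def htNaiOKN (c w : (Fin 3 × Fin 3) ⊕ Fin 3 → ℤ) (L : List (Fin 3 → ℤ)) : Bool := L.all fun b => (naiveLJ c (refW w) b).isSome

/-- The computed all-naive slope constant of a chunk (`…HomSlopeLJ.slopeGsLJ` with no centred labels). -/
def htGsN (c w : (Fin 3 × Fin 3) ⊕ Fin 3 → ℤ) (L : List (Fin 3 → ℤ)) : ℤ := slopeGsLJ c (refW w) [] L

/-- ★ **Per-chunk reference force bound, all-naive**: for a duplicate-free chunk `L` with its naive guard,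
`|Σ_{L} kernel(ξ₀)⟪X, Δ⟫| ≤ (htGsN/SC)‖Δ‖` at every `U` of the entry box and every `ξ`. [folklore chaining: `…HomSlopeLJ.forceLJ_ref_bound_of_check` with
`Lc = []`] -/
theorem refForce_chunkN_le {c w : (Fin 3 × Fin 3) ⊕ Fin 3 → ℤ} {L : List (Fin 3 → ℤ)} (hL : L.Nodup) (hn : htNaiOKN c w L = true)
    (U : E3 →L[ℝ] E3) (hU : ‖U - 1‖ ≤ 1 / 4)
    (hbox : ∀ ab : Fin 3 × Fin 3, |(U (EuclideanSpace.single ab.2 (1 : ℝ))) ab.1 - (c (Sum.inl ab) : ℝ) / SC| ≤ (w (Sum.inl ab) : ℝ) / SC)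
    (hn₀ : ‖cenShuf c‖ ≤ 1 / 4) (ξ : E3) :
    |∑ bb ∈ L.toFinset, (‖latPt U hexFrame bb + U (hcpShift + cenShuf c)‖⁻¹ ^ 8 - ‖latPt U hexFrame bb + U (hcpShift + cenShuf c)‖⁻¹ ^ 14) *
        ⟪latPt U hexFrame bb + U (hcpShift + cenShuf c), U (ξ - cenShuf c)⟫| ≤ (htGsN c w L : ℝ) / SC * ‖U (ξ - cenShuf c)‖ := by
  classical
  have hbox' : ∀ ab : Fin 3 × Fin 3, |(U (EuclideanSpace.single ab.2 (1 : ℝ))) ab.1 - (c (Sum.inl ab) : ℝ) / SC| ≤ (refW w (Sum.inl ab) : ℝ) / SC :=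
    fun ab => by rw [refW_inl]; exact hbox ab
  have hξ₀' : ∀ i : Fin 3, |cenShuf c i - (c (Sum.inr i) : ℝ) / SC| ≤ (refW w (Sum.inr i) : ℝ) / SC := by
    intro i; rw [refW_inr, cenShuf_apply, sub_self, abs_zero]; simp
  have hc : (([] : List (Fin 3 → ℤ)).all fun b => slopeLJLabelOK c (refW w) b) = true := by simp
  have hcheck := slopeCheckLJ_slopeGsLJ hc hn
  have hL' : (([] : List (Fin 3 → ℤ)) ++ L).Nodup := by simpa using hL
  have key := forceLJ_ref_bound_of_check hL' hcheck U hU hbox' (cenShuf c) hξ₀' hn₀ ξ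
  rw [List.nil_append] at key
  exact key

/-- ★ **The reference force bound over `B = htBU`** from the three chunk bounds (near chunk centred/naive split of record, far chunks all-naive):
`|Σ_B| ≤ ((htGs nearU + htGsN far₁U + htGsN far₂U)/SC)·‖Δ‖`. [folklore: additivity, verbatim `…HomEntryLeafHT3.refForce_htB_le`] -/
theorem refForce_htBU_le {c w : (Fin 3 × Fin 3) ⊕ Fin 3 → ℤ} (h1 : htNaiOK c w (htNearU c w) = true) (h2 : htNaiOKN c w (htFar1U c w) = true)
    (h3 : htNaiOKN c w (htFar2U c w) = true) (U : E3 →L[ℝ] E3) (hU : ‖U - 1‖ ≤ 1 / 4)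
    (hbox : ∀ ab : Fin 3 × Fin 3, |(U (EuclideanSpace.single ab.2 (1 : ℝ))) ab.1 - (c (Sum.inl ab) : ℝ) / SC| ≤ (w (Sum.inl ab) : ℝ) / SC)
    (hn₀ : ‖cenShuf c‖ ≤ 1 / 4) (ξ : E3) :
    |∑ bb ∈ (htBU c w).toFinset, (‖latPt U hexFrame bb + U (hcpShift + cenShuf c)‖⁻¹ ^ 8 - ‖latPt U hexFrame bb + U (hcpShift + cenShuf c)‖⁻¹ ^ 14) *
        ⟪latPt U hexFrame bb + U (hcpShift + cenShuf c), U (ξ - cenShuf c)⟫| ≤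
      ((htGs c w (htNearU c w) + htGsN c w (htFar1U c w) + htGsN c w (htFar2U c w) : ℤ) : ℝ) / SC * ‖U (ξ - cenShuf c)‖ := by
  classical
  have hN : (htNearU c w).Nodup := (htUniv_nodup c w).filter _
  have hF1 : (htFar1U c w).Nodup := (htUniv_nodup c w).filter _
  have hF2 : (htFar2U c w).Nodup := (htUniv_nodup c w).filter _
  have k1 := refForce_chunk_le hN h1 U hU hbox hn₀ ξ
  have k2 := refForce_chunkN_le hF1 h2 U hU hbox hn₀ ξ
  have k3 := refForce_chunkN_le hF2 h3 U hU hbox hn₀ ξ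
  obtain ⟨h12, _, hd3⟩ := List.nodup_append.1 (htBU_nodup c w)
  obtain ⟨_, _, hd2⟩ := List.nodup_append.1 h12
  have hd3' : List.Disjoint ((htCenU c w ++ htNaiU c w) ++ htFar1U c w) (htFar2U c w) := fun a ha hb => hd3 a ha a hb rfl
  have hd2' : List.Disjoint (htCenU c w ++ htNaiU c w) (htFar1U c w) := fun a ha hb => hd2 a ha a hb rfl
  have hnear : (htCenU c w ++ htNaiU c w).toFinset = (htNearU c w).toFinset := toFinset_filter_append (htNearU c w) fun b => isCenLJ c w b
  rw [htBU, List.toFinset_append, Finset.sum_union (List.disjoint_toFinset_iff_disjoint.2 hd3'), List.toFinset_append,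
    Finset.sum_union (List.disjoint_toFinset_iff_disjoint.2 hd2'), hnear]
  push_cast
  rw [add_div, add_div, add_mul, add_mul]
  refine (abs_add_le _ _).trans (add_le_add ((abs_add_le _ _).trans (add_le_add k1 k2)) k3)

end Summit.AtomisticToContinuum.Crystallization.Theorems.FrustratedLawDichotomyStrainedPatchHomEntryLeafHT

end
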